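import Literature.MathematicalPhysics.QuantumFieldTheory.Balaban1983to89.T4DobrushinTensorisation

/-!
# T4GaussianWhitening — linear (whitening) reparametrisation of the innovation field:
sensitivity transport, the Schur budget, and the NE1′ tower bound in whitened coordinates

(kernel-proved, `[folklore]`; finite `T⁴` bookkeeping for the NE1′ (O3b/H2) coupling line,
rung (B)+1 of the Bałaban 1983–89 audit; NOT infinite volume, NOT a mass gap, NOT Clay.)

## Why this leaf (the currency audit of MI-ES-G)

`T4DobrushinTensorisation` §7 left the tensorisation-side input of the NE1′ line as a SUP-NORM
condition on the one-step energy `A` of the innovation law `Q = gibbsMeasure π A` relative to a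
PRODUCT reference law `⊗ᵢ πᵢ`: row sums of the mixed second differences of `A` between distinct
innovation sites `≤ α₀ < 1` (record `T4-EST-NE1p-P2.md` v1.20, MI-ES-G).  In the RAW fluctuation
coordinates of one renormalisation step (the fluctuation field on bonds / blocks of the unit
lattice, with its a-priori law a CORRELATED Gaussian `dμ_{C^{(k)}}` — B12 (2.12)–(2.13)) that
condition cannot hold with a product reference: the quadratic form itself couples neighbouring
sites with `O(1)` coefficients, so the mixed second differences over the small-field range are
`≫ 1`.  The repair is the standard one: WHITEN the Gaussian part.  A finite-dimensional Gaussian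
law with mean `m` and covariance `C` is the image of the PRODUCT of unit Gaussians under the
affine map `η ↦ m + S η` (`S Sᵀ = C`, e.g. `S = C^{1/2}`); after this change of variables the
reference law IS a product, the interaction `V ∘ (m + S·)` is the only source of dependence, and
its mixed second differences are small as soon as `V` has small second-order variation and the
columns of `|S|` are summable — the format of `T4DobrushinTensorisation.efronSteinWith_of_gibbs`.
What the whitening costs on the SENSITIVITY side is the content of this file: replacing ONE
whitened coordinate `ηᵢ` moves EVERY raw coordinate `ξ_l` by `S l i · (ηᵢ' − ηᵢ)`, so the
single-innovation sensitivities of the next effective observable — which the record states (and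
print is to be asked for) in RAW coordinates, `|∂_l g| ≤ c_l` on a coordinate box — transport to
`c'_i = ∑_l c_l |S l i|` (§2, a telescoping / hybrid argument, §1), and the squared budget
inflates by at most the Schur factor `(sup_l ∑ᵢ |S l i|)·(supᵢ ∑_l |S l i|)` (§3, Cauchy–Schwarz).
§4–§5 push this through the one-step incoherence bound and the end-to-end tower bound of
`T4CouplingIncoherence` §8–§9, §7 through the Gibbs form of `T4DobrushinTensorisation` §7; §6 of
this file discharges the resampling second moments in whitened coordinates from the ONE-SITE
oscillation of the energy and the second moment / support radius of the single-site reference law.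
(The raw-coordinate obstruction above is an analysis remark of the record, v1.21 (N1); nothing of
it is used or asserted in the kernel.)

After this leaf the analysis input of the NE1′ coupling line on the tensorisation side reads, per
step `b` and history `h` (record v1.21, MI-ES-W): the innovation law of the step, restricted to its
small-field event, is the image under a measurable map `T_{b,h} ∘ (m_{b,h} + S_{b,h} ·)` of a Gibbs
law `gibbsMeasure π A_{b,h}` for a PRODUCT reference law on the whitened sites, with (W1) uniformly
summable rows and columns of `|S_{b,h}|`, (W2) mixed-second-difference row sums of `A_{b,h}`
`≤ α₀ < 1`, (W3) a one-site oscillation bound for `A_{b,h}`; plus the RAW graded sensitivities and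
the graded-geometric profile of v1.16–v1.20, unchanged.  Where these come from for the printed
actions (propagator decay, analyticity on the small-field domains, localisation) is LOCATED in the
record, not proved, not cited and not asserted here.

## Contents

§1 `LipOn` (coordinate-wise Lipschitz vector of a function of the raw field on a coordinate box)
and the hybrid bound `|F ξ' − F ξ| ≤ ∑_l c_l |ξ'_l − ξ_l|` · §2 the affine reparametrisation
`affine m S e η = (l ↦ m l + ∑ᵢ S l i · eᵢ (ηᵢ))` (whitened sites `i : ι` with value types `E i`
read through measurable coordinates `eᵢ : E i → ℝ` — `ℝ` itself, a small-field interval as a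
subtype, a finite grid …), `affine_update`, measurability, and the SENSITIVITY TRANSPORT
`LipOn.transport` · §3 the Schur / Cauchy–Schwarz budget `sum_sq_transport_le` · §4 ONE STEP:
`oneStepVar ≤ C_T · ½ ∑_l c_l² · (s_r s_c τ²)` under a whitened representation
(`oneStepVar_le_of_whitenedRep`) · §5 END TO END on the realised chain and for an arbitrary path
law (`integral_sq_sub_towerMean_le_of_graded_geometric_whitened(_pathLaw)`) · §6 resampling
second moments of one-site Gibbs kernels from the one-site oscillation
(`gibbsDensity_le_exp_of_osc`, `integral_gibbsKernel_le_exp_mul`, `integrable_sq_sub_gibbsKernel`,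
`integral_sq_sub_gibbsKernel_le`) · §7 the GIBBS forms (`…_whitenedGibbs_pathLaw`: `hES`
discharged by `efronSteinWith_of_gibbs_linear`, `C_T = 1/(1−α₀)`; `…_whitenedGibbs_boxed_pathLaw`:
in addition the moment binders discharged by §6, `τ_b² = e^ω (2v + 2p_b²)`).

## Honest flags

* `[folklore]` throughout: every declaration is proved here from Mathlib and the lineage leaves;
  NO `def X : Prop` named fact, no cite tag, nothing taken as a hypothesis from print (the one
  `def … : Prop` of this file, `LipOn`, is a NAME FOR A HYPOTHESIS SHAPE, unfolded on demand).
  Dictionary remarks (not inputs): the a-priori fluctuation law of one small-field step is the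
  Gaussian `dμ_{C^{(k)}}(B)`, `C^{(k)} = (C*Δ^{(k)}C)^{-1}`, tilted by `χ_k exp [P^{(k)} + {…}]` with
  `P^{(k)}` analytic and bounded by an `O(g_k)` second-order polynomial on the small-field region
  (B12 = Bałaban, Comm. Math. Phys. 109 (1987), (2.12)–(2.13) and §3, pp. 268–269 — the manuscript
  under audit: quoted for ORIENTATION only, never as a fact); the whitening `B = C^{1/2} W` with a
  PRODUCT small-field cutoff in `W` is performed explicitly in Dimock's template (arXiv:1108.1335,
  the fluctuation integral with `dμ_I(W)` a product of unit Gaussians and the bounds on `C_k^{1/2}`)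
  — again orientation, not input.  That a finite-dimensional Gaussian law is the affine image of
  a product of unit Gaussians is textbook linear algebra; this file does not even use it: the
  whitened representation `κ b h = (Q b h).map (T b h ∘ affine …)` is a DISPLAYED HYPOTHESIS.
* Nothing here touches `BetaPertH` / (B) / (B^μ): measure-theoretic and finite-sum bookkeeping;
  the analysis inputs it isolates (W1)–(W3) and the raw graded sensitivities are where B4–B16
  enter — LOCATED in the record, not proved, not cited.
* Finite `T⁴`, finitely many raw and whitened sites (`[Fintype Λ]`, `[Fintype ι]`); bounded
  measurable observables; in §6–§7 a BOUNDED energy and probability reference laws — the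
  small-field format; large fields are routed through the graded profile exactly as in
  `T4CouplingIncoherence` §7, not through `α₀`.
-/

noncomputable section

open MeasureTheory ProbabilityTheory Finset Function
open scoped ENNReal

namespace Literature.MathematicalPhysics.QuantumFieldTheory.Balaban1983to89.T4GaussianWhitening

open Literature.MathematicalPhysics.QuantumFieldTheory.Balaban1983to89.T4CouplingChain
open Literature.MathematicalPhysics.QuantumFieldTheory.Balaban1983to89.T4CouplingIncoherence
open Literature.MathematicalPhysics.QuantumFieldTheory.Balaban1983to89.T4DobrushinTensorisation

universe u v w

/-! ## §1 Coordinate-wise Lipschitz vectors on a coordinate box; the hybrid bound -/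

section Lipschitz

variable {Λ : Type w} [DecidableEq Λ]

/-- `[folklore]` `LipOn D F c`: on the coordinate box `{ξ | ∀ l, ξ l ∈ D l}`, replacing the raw
coordinate `l` by a value `t ∈ D l` moves `F` by at most `c l * |t − ξ l|` (a coordinate-wise
Lipschitz vector for `F` on the box — the shape of single-block derivative bounds of an effective
observable on a small-field domain).  A NAME FOR A HYPOTHESIS SHAPE, not an asserted fact. -/
def LipOn (D : Λ → Set ℝ) (F : (Λ → ℝ) → ℝ) (c : Λ → ℝ) : Prop :=
  ∀ ξ : Λ → ℝ, (∀ l, ξ l ∈ D l) → ∀ (l : Λ) (t : ℝ), t ∈ D l →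
    |F (update ξ l t) - F ξ| ≤ c l * |t - ξ l|

variable {D : Λ → Set ℝ} {F : (Λ → ℝ) → ℝ} {c : Λ → ℝ}

omit [DecidableEq Λ] in
/-- `[folklore]` A hybrid of two configurations of the box lies in the box. -/
theorem piecewise_mem_box {ξ ξ' : Λ → ℝ} (hξ : ∀ l, ξ l ∈ D l) (hξ' : ∀ l, ξ' l ∈ D l)
    (s : Finset Λ) [∀ l, Decidable (l ∈ s)] (l : Λ) : s.piecewise ξ' ξ l ∈ D l := by
  by_cases hl : l ∈ s
  · rw [Finset.piecewise_eq_of_mem _ _ _ hl]; exact hξ' l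
  · rw [Finset.piecewise_eq_of_notMem _ _ _ hl]; exact hξ l

/-- `[folklore]` A global coordinate-wise Lipschitz vector is one on every box. -/
theorem LipOn.of_forall (h : ∀ (ξ : Λ → ℝ) (l : Λ) (t : ℝ), |F (update ξ l t) - F ξ| ≤ c l * |t - ξ l|) :
    LipOn D F c :=
  fun ξ _ l t _ => h ξ l t

/-- `[folklore]` Restricting the box preserves the Lipschitz vector. -/
theorem LipOn.mono {D' : Λ → Set ℝ} (hF : LipOn D F c) (hD : ∀ l, D' l ⊆ D l) : LipOn D' F c :=
  fun ξ hξ l t ht => hF ξ (fun l => hD l (hξ l)) l t (hD l ht)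

/-- `[folklore]` HYBRID (telescoping) BOUND: changing the coordinates in `s` from `ξ` to `ξ'`
(both in the box) moves `F` by at most `∑_{l ∈ s} c l * |ξ' l − ξ l|`. -/
theorem LipOn.abs_sub_piecewise_le (hF : LipOn D F c) {ξ ξ' : Λ → ℝ} (hξ : ∀ l, ξ l ∈ D l)
    (hξ' : ∀ l, ξ' l ∈ D l) (s : Finset Λ) :
    |F (s.piecewise ξ' ξ) - F ξ| ≤ ∑ l ∈ s, c l * |ξ' l - ξ l| := by
  induction s using Finset.induction_on with
  | empty => simp
  | @insert j s hj ih =>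
    rw [Finset.piecewise_insert, Finset.sum_insert hj]
    have hbox : ∀ l, s.piecewise ξ' ξ l ∈ D l := piecewise_mem_box hξ hξ' s
    have h1 : |F (update (s.piecewise ξ' ξ) j (ξ' j)) - F (s.piecewise ξ' ξ)| ≤ c j * |ξ' j - ξ j| := by
      have h2 := hF (s.piecewise ξ' ξ) hbox j (ξ' j) (hξ' j)
      rwa [Finset.piecewise_eq_of_notMem _ _ _ hj] at h2
    calc |F (update (s.piecewise ξ' ξ) j (ξ' j)) - F ξ|
        ≤ |F (update (s.piecewise ξ' ξ) j (ξ' j)) - F (s.piecewise ξ' ξ)|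
            + |F (s.piecewise ξ' ξ) - F ξ| := abs_sub_le _ _ _
      _ ≤ c j * |ξ' j - ξ j| + ∑ l ∈ s, c l * |ξ' l - ξ l| := add_le_add h1 ih

/-- `[folklore]` TOTAL HYBRID BOUND `|F ξ' − F ξ| ≤ ∑_l c l * |ξ' l − ξ l|` on the box. -/
theorem LipOn.abs_sub_le_sum [Fintype Λ] (hF : LipOn D F c) {ξ ξ' : Λ → ℝ} (hξ : ∀ l, ξ l ∈ D l)
    (hξ' : ∀ l, ξ' l ∈ D l) : |F ξ' - F ξ| ≤ ∑ l, c l * |ξ' l - ξ l| := by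
  have h := hF.abs_sub_piecewise_le hξ hξ' Finset.univ
  rwa [Finset.piecewise_univ] at h

end Lipschitz

/-! ## §2 The affine (whitening) reparametrisation and the sensitivity transport -/

section Affine

variable {Λ : Type w} {ι : Type u} [Fintype ι] {E : ι → Type v}

/-- `[folklore]` The affine reparametrisation of the raw field by the whitened field:
`affine m S e η l = m l + ∑ᵢ S l i · eᵢ (ηᵢ)` (mean `m`, mixing matrix `S`, coordinate readings
`eᵢ : E i → ℝ` of the whitened single-site values). -/
def affine (m : Λ → ℝ) (S : Λ → ι → ℝ) (e : (i : ι) → E i → ℝ) (η : (i : ι) → E i) : Λ → ℝ :=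
  fun l => m l + ∑ i, S l i * e i (η i)

/-- `[folklore]` Unfolding of `affine`. -/
theorem affine_apply (m : Λ → ℝ) (S : Λ → ι → ℝ) (e : (i : ι) → E i → ℝ) (η : (i : ι) → E i)
    (l : Λ) : affine m S e η l = m l + ∑ i, S l i * e i (η i) := rfl

/-- `[folklore]` Replacing the whitened coordinate `i` shifts every raw coordinate `l` by
`S l i · (eᵢ y − eᵢ ηᵢ)`. -/
theorem affine_update [DecidableEq ι] (m : Λ → ℝ) (S : Λ → ι → ℝ) (e : (i : ι) → E i → ℝ)
    (η : (i : ι) → E i) (i : ι) (y : E i) (l : Λ) :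
    affine m S e (update η i y) l = affine m S e η l + S l i * (e i y - e i (η i)) := by
  simp only [affine]
  have h : (fun j => S l j * e j (update η i y j)) =
      update (fun j => S l j * e j (η j)) i (S l i * e i y) := by
    funext j
    exact Function.apply_update (fun j (x : E j) => S l j * e j x) η i y j
  rw [h, Finset.sum_update_of_mem (Finset.mem_univ i), Finset.sdiff_singleton_eq_erase,
    ← Finset.add_sum_erase Finset.univ (fun j => S l j * e j (η j)) (Finset.mem_univ i)]
  ring

/-- `[folklore]` The affine reparametrisation is measurable (finite sums of measurable readings). -/
theorem measurable_affine [∀ i, MeasurableSpace (E i)] (m : Λ → ℝ) (S : Λ → ι → ℝ)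
    {e : (i : ι) → E i → ℝ} (he : ∀ i, Measurable (e i)) : Measurable (affine m S e) := by
  refine measurable_pi_lambda _ fun l => measurable_const.add ?_
  exact Finset.measurable_sum _ fun i _ => ((he i).comp (measurable_pi_apply i)).const_mul _

/-- `[folklore]` The image of the whitened configurations lies in the raw box `D` — hypothesis
shape `∀ η l, affine m S e η l ∈ D l`; it holds e.g. for `D l = [m l − ρ l, m l + ρ l]` as soon as
`∑ᵢ |S l i| · sup |eᵢ| ≤ ρ l`.  This lemma records that sufficient condition. -/
theorem affine_mem_Icc (m : Λ → ℝ) (S : Λ → ι → ℝ) {e : (i : ι) → E i → ℝ} {p : ℝ}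
    (he : ∀ i x, |e i x| ≤ p) {ρ : Λ → ℝ} (hρ : ∀ l, (∑ i, |S l i|) * p ≤ ρ l)
    (η : (i : ι) → E i) (l : Λ) : affine m S e η l ∈ Set.Icc (m l - ρ l) (m l + ρ l) := by
  have h1 : |∑ i, S l i * e i (η i)| ≤ ρ l := by
    calc |∑ i, S l i * e i (η i)| ≤ ∑ i, |S l i * e i (η i)| := Finset.abs_sum_le_sum_abs _ _
      _ = ∑ i, |S l i| * |e i (η i)| := Finset.sum_congr rfl fun i _ => abs_mul _ _
      _ ≤ ∑ i, |S l i| * p := Finset.sum_le_sum fun i _ =>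
          mul_le_mul_of_nonneg_left (he i _) (abs_nonneg _)
      _ = (∑ i, |S l i|) * p := (Finset.sum_mul _ _ _).symm
      _ ≤ ρ l := hρ l
  rw [affine_apply, Set.mem_Icc]
  constructor <;> linarith [(abs_le.mp h1).1, (abs_le.mp h1).2]

/-- `[folklore]` **SENSITIVITY TRANSPORT THROUGH THE WHITENING.**  If the raw coordinates carry
the Lipschitz vector `c` on a box `D` containing the image of the whitened configurations, then
replacing the whitened coordinate `i` moves `F ∘ affine` by at most
`(∑_l c l · |S l i|) · |eᵢ y − eᵢ ηᵢ|`. -/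
theorem LipOn.transport [Fintype Λ] [DecidableEq Λ] [DecidableEq ι] {D : Λ → Set ℝ}
    {F : (Λ → ℝ) → ℝ} {c : Λ → ℝ} (hF : LipOn D F c) {m : Λ → ℝ} {S : Λ → ι → ℝ}
    {e : (i : ι) → E i → ℝ} (hD : ∀ η l, affine m S e η l ∈ D l) (η : (i : ι) → E i) (i : ι)
    (y : E i) :
    |F (affine m S e η) - F (affine m S e (update η i y))| ≤
      (∑ l, c l * |S l i|) * |e i y - e i (η i)| := by
  rw [abs_sub_comm]
  refine (hF.abs_sub_le_sum (hD η) (hD (update η i y))).trans (le_of_eq ?_)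
  rw [Finset.sum_mul]
  refine Finset.sum_congr rfl fun l _ => ?_
  rw [affine_update, add_sub_cancel_left, abs_mul, mul_assoc]

end Affine

/-! ## §3 The Schur / Cauchy–Schwarz budget of the transported sensitivities -/

section Schur

variable {Λ : Type w} [Fintype Λ] {ι : Type u} [Fintype ι]

/-- `[folklore]` Weighted Cauchy–Schwarz: `(∑_l c l · a l)² ≤ (∑_l a l) · ∑_l c l² · a l` for
weights `a l ≥ 0`. -/
theorem sq_sum_mul_le_mul_sum (c a : Λ → ℝ) (ha : ∀ l, 0 ≤ a l) :
    (∑ l, c l * a l) ^ 2 ≤ (∑ l, a l) * ∑ l, c l ^ 2 * a l := by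
  have h := Finset.sum_mul_sq_le_sq_mul_sq Finset.univ (fun l => Real.sqrt (a l))
    (fun l => c l * Real.sqrt (a l))
  have h1 : ∀ l, Real.sqrt (a l) * (c l * Real.sqrt (a l)) = c l * a l := fun l => by
    calc Real.sqrt (a l) * (c l * Real.sqrt (a l))
        = c l * (Real.sqrt (a l) * Real.sqrt (a l)) := by ring
      _ = c l * a l := by rw [Real.mul_self_sqrt (ha l)]
  have h2 : ∀ l, Real.sqrt (a l) ^ 2 = a l := fun l => Real.sq_sqrt (ha l)
  have h3 : ∀ l, (c l * Real.sqrt (a l)) ^ 2 = c l ^ 2 * a l := fun l => by rw [mul_pow, h2]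
  simp only [h1, h2, h3] at h
  exact h

/-- `[folklore]` **THE SCHUR BUDGET.**  With column sums `∑_l |S l i| ≤ s_c` and row sums
`∑ᵢ |S l i| ≤ s_r` of `|S|`, the squared transported sensitivities weighted by `τ² ≥ 0` satisfy
`∑ᵢ (∑_l c l |S l i|)² · τ² ≤ ∑_l c l² · (s_r s_c τ²)`. -/
theorem sum_sq_transport_le (c : Λ → ℝ) (S : Λ → ι → ℝ) {τsq sr sc : ℝ} (hτ : 0 ≤ τsq)
    (hsc : 0 ≤ sc) (hcol : ∀ i, ∑ l, |S l i| ≤ sc) (hrow : ∀ l, ∑ i, |S l i| ≤ sr) :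
    ∑ i, (∑ l, c l * |S l i|) ^ 2 * τsq ≤ ∑ l, c l ^ 2 * (sr * sc * τsq) := by
  have h1 : ∀ i, (∑ l, c l * |S l i|) ^ 2 * τsq ≤ (sc * ∑ l, c l ^ 2 * |S l i|) * τsq := fun i => by
    refine mul_le_mul_of_nonneg_right ?_ hτ
    have hnn : 0 ≤ ∑ l, c l ^ 2 * |S l i| :=
      Finset.sum_nonneg fun l _ => mul_nonneg (sq_nonneg _) (abs_nonneg _)
    exact (sq_sum_mul_le_mul_sum c (fun l => |S l i|) fun l => abs_nonneg _).trans
      (mul_le_mul_of_nonneg_right (hcol i) hnn)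
  calc ∑ i, (∑ l, c l * |S l i|) ^ 2 * τsq
      ≤ ∑ i, (sc * ∑ l, c l ^ 2 * |S l i|) * τsq := Finset.sum_le_sum fun i _ => h1 i
    _ = sc * τsq * ∑ i, ∑ l, c l ^ 2 * |S l i| := by
        rw [Finset.mul_sum]
        exact Finset.sum_congr rfl fun i _ => by ring
    _ = sc * τsq * ∑ l, c l ^ 2 * ∑ i, |S l i| := by
        rw [Finset.sum_comm]
        congr 1
        exact Finset.sum_congr rfl fun l _ => (Finset.mul_sum _ _ _).symm
    _ ≤ sc * τsq * ∑ l, c l ^ 2 * sr :=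
        mul_le_mul_of_nonneg_left
          (Finset.sum_le_sum fun l _ => mul_le_mul_of_nonneg_left (hrow l) (sq_nonneg _))
          (mul_nonneg hsc hτ)
    _ = ∑ l, c l ^ 2 * (sr * sc * τsq) := by
        rw [Finset.mul_sum]
        exact Finset.sum_congr rfl fun l _ => by ring

end Schur

/-! ## §4 ONE STEP: incoherence under a whitened representation

The step law at the history `h` is `κ b h = Q.map (T ∘ affine m S e)`: a law `Q` on the WHITENED
innovation field (satisfying the Efron–Stein inequality `hES` with kernels `qᵢ` and constant
`C_T` — for a product `Q`, `C_T = 1`; for a Gibbs law with small mixed second differences, §7),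
pushed through the affine reparametrisation and the raw representing map `T`.  The raw next
effective observable `ξ ↦ fiberMean κ (b+1) φ (succGlue b (h, T ξ))` carries a Lipschitz vector
`c` on a raw box containing the whitened image; the resampling second moments of the readings
`eᵢ` under the kernels `qᵢ` are `≤ τ²`.  Then `oneStepVar κ b φ h ≤ C_T · ½ ∑_l c_l² · (s_r s_c τ²)`:
the RAW sensitivities survive, the whitening costs the Schur factor `s_r s_c`. -/

section OneStep

open Preorder MeasureTheory.Filtration

variable {X : ℕ → Type*} [∀ n, MeasurableSpace (X n)]
variable {κ : (b : ℕ) → Kernel (Π i : Iic b, X i) (X (b + 1))} [∀ b, IsMarkovKernel (κ b)]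

/-- `[folklore]` **ONE-STEP INCOHERENCE UNDER A WHITENED REPRESENTATION.** -/
theorem oneStepVar_le_of_whitenedRep (b : ℕ) {φ : (Π n, X n) → ℝ} (hφm : StronglyMeasurable φ)
    {R : ℝ} (hφR : ∀ x, |φ x| ≤ R) (h : Π i : Iic b, X i)
    {Λ : Type w} [Fintype Λ] [DecidableEq Λ] {ι : Type u} [Fintype ι] [DecidableEq ι]
    {E : ι → Type v} [∀ i, MeasurableSpace (E i)]
    {T : (Λ → ℝ) → X (b + 1)} (hT : Measurable T) (m : Λ → ℝ) (S : Λ → ι → ℝ)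
    {e : (i : ι) → E i → ℝ} (he : ∀ i, Measurable (e i))
    (Q : Measure ((i : ι) → E i)) [IsProbabilityMeasure Q]
    (hrep : κ b h = Q.map (fun η => T (affine m S e η)))
    (q : (i : ι) → Kernel ((j : ι) → E j) (E i)) {CT : ℝ} (hCT : 0 ≤ CT)
    (hES : ∀ (G : ((i : ι) → E i) → ℝ) (B : ℝ), Measurable G → (∀ ξ, |G ξ| ≤ B) →
      ∫ ξ, (G ξ - ∫ ζ, G ζ ∂Q) ^ 2 ∂Q ≤
        CT * ((1 / 2 : ℝ) * ∑ i, ∫ ξ, (∫ y, (G ξ - G (Function.update ξ i y)) ^ 2 ∂(q i ξ)) ∂Q))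
    {D : Λ → Set ℝ} (hD : ∀ η l, affine m S e η l ∈ D l) {c : Λ → ℝ}
    (hc : LipOn D (fun ξ => fiberMean κ (b + 1) φ (succGlue b (h, T ξ))) c)
    {τsq : ℝ} (hτ : 0 ≤ τsq)
    (hdi : ∀ i η, Integrable (fun y => (e i y - e i (η i)) ^ 2) (q i η))
    (hmom : ∀ i η, ∫ y, (e i y - e i (η i)) ^ 2 ∂(q i η) ≤ τsq)
    {sr sc : ℝ} (hsc : 0 ≤ sc) (hcol : ∀ i, ∑ l, |S l i| ≤ sc) (hrow : ∀ l, ∑ i, |S l i| ≤ sr) :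
    oneStepVar κ b φ h ≤ CT * ((1 / 2 : ℝ) * ∑ l, c l ^ 2 * (sr * sc * τsq)) := by
  have hTa : Measurable (fun η => T (affine m S e η)) := hT.comp (measurable_affine m S he)
  have hdi' : ∀ i η, Integrable (fun y => |e i y - e i (η i)| ^ 2) (q i η) := fun i η => by
    simp_rw [sq_abs]; exact hdi i η
  have hmom' : ∀ i η, ∫ y, |e i y - e i (η i)| ^ 2 ∂(q i η) ≤ τsq := fun i η => by
    simp_rw [sq_abs]; exact hmom i η
  have h1 := oneStepVar_le_of_rep_efronSteinWith (κ := κ) b hφm hφR h hTa Q hrep q hCT hES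
    (c := fun i => ∑ l, c l * |S l i|) (d := fun i x y => |e i y - e i x|) hdi' hmom'
    (fun i η y => hc.transport hD η i y)
  refine h1.trans (mul_le_mul_of_nonneg_left (mul_le_mul_of_nonneg_left ?_ (by norm_num)) hCT)
  exact sum_sq_transport_le c S hτ hsc hcol hrow

end OneStep

/-! ## §5 END TO END in whitened coordinates (`T4CouplingIncoherence` §8(a) step-budget chain)

Per step `b < n` and history `h`: a whitened representation as in §4 with data
`T b h, m b h, S b h, Q b h, q b h i` and UNIFORM constants `C_T, s_r, s_c`; level-wise second
moments `τ b ²` (level dependence allowed: it is folded into the profile, `hgeo` is asked with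
`Θ b · τ b`); RAW graded sensitivities `c b h l` on felt sets `Mf b` with irregularity events of
the history, product-dominated, and geometric felt counts — exactly the graded-geometric data of
`T4CouplingIncoherence` §7(c), in RAW coordinates.  Conclusion:
`∫ (φ − towerMean)² dμ ≤ C_T · ½ C² (s_r s_c) · ν(X 0) · e^{(κ₁²−1)E} · P/(1−r)`. -/

section EndToEnd

open Preorder MeasureTheory.Filtration

variable {X : ℕ → Type*} [∀ n, MeasurableSpace (X n)]
variable {κ : (b : ℕ) → Kernel (Π i : Iic b, X i) (X (b + 1))} [∀ b, IsMarkovKernel (κ b)]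

open scoped Classical in
/-- `[folklore]` **MI-ES END-TO-END, WHITENED FORM (realised chain).** -/
theorem integral_sq_sub_towerMean_le_of_graded_geometric_whitened (ν : Measure (X 0))
    [IsFiniteMeasure ν] (n : ℕ) {φ : (Π k, X k) → ℝ} (hφn : StronglyMeasurable[piLE (X := X) n] φ)
    {R : ℝ} (hφR : ∀ x, |φ x| ≤ R)
    {Λ : ℕ → Type w} [∀ b, Fintype (Λ b)] [∀ b, DecidableEq (Λ b)]
    {ι : ℕ → Type u} [∀ b, Fintype (ι b)] [∀ b, DecidableEq (ι b)] {E : (b : ℕ) → ι b → Type v}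
    [∀ b i, MeasurableSpace (E b i)]
    {T : (b : ℕ) → (Π i : Iic b, X i) → (Λ b → ℝ) → X (b + 1)} (hT : ∀ b h, Measurable (T b h))
    (m : (b : ℕ) → (Π i : Iic b, X i) → Λ b → ℝ)
    (S : (b : ℕ) → (Π i : Iic b, X i) → Λ b → ι b → ℝ)
    {e : (b : ℕ) → (i : ι b) → E b i → ℝ} (he : ∀ b i, Measurable (e b i))
    (Q : (b : ℕ) → (Π i : Iic b, X i) → Measure ((i : ι b) → E b i))
    [∀ b h, IsProbabilityMeasure (Q b h)]
    (hrep : ∀ b < n, ∀ h, κ b h = (Q b h).map (fun η => T b h (affine (m b h) (S b h) (e b) η)))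
    (q : (b : ℕ) → (Π i : Iic b, X i) → (i : ι b) → Kernel ((j : ι b) → E b j) (E b i))
    {CT : ℝ} (hCT : 0 ≤ CT)
    (hES : ∀ b < n, ∀ h, ∀ (G : ((i : ι b) → E b i) → ℝ) (B : ℝ), Measurable G →
      (∀ ξ, |G ξ| ≤ B) → ∫ ξ, (G ξ - ∫ ζ, G ζ ∂Q b h) ^ 2 ∂Q b h ≤
        CT * ((1 / 2 : ℝ) * ∑ i, ∫ ξ, (∫ y, (G ξ - G (Function.update ξ i y)) ^ 2
          ∂(q b h i ξ)) ∂Q b h))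
    {D : (b : ℕ) → (Π i : Iic b, X i) → Λ b → Set ℝ}
    (hD : ∀ b < n, ∀ h η l, affine (m b h) (S b h) (e b) η l ∈ D b h l)
    {c : (b : ℕ) → (Π i : Iic b, X i) → Λ b → ℝ}
    (hc : ∀ b < n, ∀ h, LipOn (D b h) (fun ξ => fiberMean κ (b + 1) φ (succGlue b (h, T b h ξ)))
      (c b h))
    {τ : ℕ → ℝ} (hτ0 : ∀ b, 0 ≤ τ b)
    (hdi : ∀ b < n, ∀ h i η, Integrable (fun y => (e b i y - e b i (η i)) ^ 2) (q b h i η))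
    (hmom : ∀ b < n, ∀ h i η, ∫ y, (e b i y - e b i (η i)) ^ 2 ∂(q b h i η) ≤ τ b ^ 2)
    {sr sc : ℝ} (hsr : 0 ≤ sr) (hsc : 0 ≤ sc) (hcol : ∀ b < n, ∀ h i, ∑ l, |S b h l i| ≤ sc)
    (hrow : ∀ b < n, ∀ h l, ∑ i, |S b h l i| ≤ sr)
    (hWm : ∀ b, StronglyMeasurable (fun h => ∑ l, c b h l ^ 2)) {CW : ℝ}
    (hWb : ∀ b h, |∑ l, c b h l ^ 2| ≤ CW)
    (Mf : (b : ℕ) → Finset (Λ b)) {C κ₁ Etot : ℝ} (hκ₁ : 1 ≤ κ₁) {Θ : ℕ → ℝ}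
    {J : ℕ → Type*} (Jset : (b : ℕ) → Λ b → Finset (J b))
    {A : (b : ℕ) → Λ b → J b → Set (Π i : Iic b, X i)}
    (hA : ∀ b < n, ∀ l ∈ Mf b, ∀ j ∈ Jset b l, MeasurableSet (A b l j))
    (hc0 : ∀ b < n, ∀ h, ∀ l ∉ Mf b, c b h l = 0)
    (hcg : ∀ b < n, ∀ h, ∀ l ∈ Mf b,
      |c b h l| ≤ C * Θ b * κ₁ ^ ((Jset b l).filter fun j => h ∈ A b l j).card)
    {ε : (b : ℕ) → Λ b → J b → ℝ} (hε : ∀ b < n, ∀ l ∈ Mf b, ∀ j ∈ Jset b l, 0 ≤ ε b l j)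
    (hE : ∀ b < n, ∀ l ∈ Mf b, ∑ j ∈ Jset b l, ε b l j ≤ Etot)
    (hdomA : ∀ b < n, ∀ l ∈ Mf b, ∀ S' ⊆ Jset b l,
      (Kernel.trajMeasure ν κ).real (⋂ j ∈ S', {x | frestrictLe b x ∈ A b l j}) ≤
        (Kernel.trajMeasure ν κ).real Set.univ * ∏ j ∈ S', ε b l j)
    {P r : ℝ} (hP : 0 ≤ P) (hr0 : 0 ≤ r) (hr1 : r < 1)
    (hgeo : ∀ b, ((Mf b).card : ℝ) * (Θ b * τ b) ^ 2 ≤ P * r ^ b) :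
    ∫ x, (φ x - towerMean κ φ (x 0)) ^ 2 ∂(Kernel.trajMeasure ν κ) ≤
      CT * ((1 / 2 : ℝ) * (C ^ 2 * (sr * sc)) *
        (ν.real Set.univ * Real.exp ((κ₁ ^ 2 - 1) * Etot)) * (P / (1 - r))) := by
  have hφm : StronglyMeasurable φ := hφn.mono ((piLE (X := X)).le n)
  -- effective sensitivities `τ b · c b h l` (zero beyond the depth) and the constant moment `s_r s_c`
  set c' : (b : ℕ) → (Π i : Iic b, X i) → Λ b → ℝ :=
    fun b h l => if b < n then τ b * c b h l else 0 with hc'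
  have hstep : ∀ b < n, ∀ h,
      oneStepVar κ b φ h ≤ CT * ((1 / 2 : ℝ) * ∑ l, c' b h l ^ 2 * (sr * sc)) := by
    intro b hb h
    have h1 := oneStepVar_le_of_whitenedRep (κ := κ) b hφm hφR h (hT b h) (m b h) (S b h) (he b)
      (Q b h) (hrep b hb h) (q b h) hCT (hES b hb h) (hD b hb h) (hc b hb h) (sq_nonneg (τ b))
      (hdi b hb h) (hmom b hb h) hsc (hcol b hb h) (hrow b hb h)
    refine h1.trans (le_of_eq ?_)
    congr 2
    refine Finset.sum_congr rfl fun l _ => ?_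
    simp only [hc', if_pos hb]
    ring
  have hWm' : ∀ b, StronglyMeasurable (fun h => ∑ l, c' b h l ^ 2 * (sr * sc)) := by
    intro b
    by_cases hb : b < n
    · have h1 : (fun h => ∑ l, c' b h l ^ 2 * (sr * sc)) =
          fun h => (τ b ^ 2 * (sr * sc)) * ∑ l, c b h l ^ 2 := by
        funext h
        simp only [hc', if_pos hb]
        rw [Finset.mul_sum]
        exact Finset.sum_congr rfl fun l _ => by ring
      rw [h1]
      exact (hWm b).const_mul _
    · have h1 : (fun h => ∑ l, c' b h l ^ 2 * (sr * sc)) = fun _ => 0 := by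
        funext h
        simp [hc', if_neg hb]
      rw [h1]
      exact stronglyMeasurable_const
  -- a crude uniform bound on the effective budgets: `(∑_{b<n} τ b²)·(s_r s_c |CW|)`
  set Tn : ℝ := ∑ b ∈ range n, τ b ^ 2 with hTn
  have hTn0 : 0 ≤ Tn := Finset.sum_nonneg fun b _ => sq_nonneg (τ b)
  have hWb' : ∀ b h, |∑ l, c' b h l ^ 2 * (sr * sc)| ≤ Tn * (sr * sc * |CW|) := by
    intro b h
    by_cases hb : b < n
    · have h1 : ∑ l, c' b h l ^ 2 * (sr * sc) = (τ b ^ 2 * (sr * sc)) * ∑ l, c b h l ^ 2 := by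
        simp only [hc', if_pos hb]
        rw [Finset.mul_sum]
        exact Finset.sum_congr rfl fun l _ => by ring
      have hτle : τ b ^ 2 ≤ Tn := by
        rw [hTn]
        exact Finset.single_le_sum (f := fun b => τ b ^ 2) (fun b _ => sq_nonneg (τ b))
          (Finset.mem_range.mpr hb)
      rw [h1, abs_mul, abs_of_nonneg (mul_nonneg (sq_nonneg _) (mul_nonneg hsr hsc))]
      calc τ b ^ 2 * (sr * sc) * |∑ l, c b h l ^ 2|
          ≤ τ b ^ 2 * (sr * sc) * |CW| :=
            mul_le_mul_of_nonneg_left ((hWb b h).trans (le_abs_self CW))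
              (mul_nonneg (sq_nonneg _) (mul_nonneg hsr hsc))
        _ = τ b ^ 2 * (sr * sc * |CW|) := by ring
        _ ≤ Tn * (sr * sc * |CW|) :=
            mul_le_mul_of_nonneg_right hτle (mul_nonneg (mul_nonneg hsr hsc) (abs_nonneg _))
    · have h1 : ∑ l, c' b h l ^ 2 * (sr * sc) = 0 := by simp [hc', if_neg hb]
      rw [h1, abs_zero]
      exact mul_nonneg hTn0 (mul_nonneg (mul_nonneg hsr hsc) (abs_nonneg _))
  have hc0' : ∀ b < n, ∀ h, ∀ l ∉ Mf b, c' b h l = 0 := fun b hb h l hl => by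
    simp only [hc', if_pos hb, hc0 b hb h l hl, mul_zero]
  have hcg' : ∀ b < n, ∀ h, ∀ l ∈ Mf b,
      |c' b h l| ≤ C * (Θ b * τ b) * κ₁ ^ ((Jset b l).filter fun j => h ∈ A b l j).card := by
    intro b hb h l hl
    simp only [hc', if_pos hb]
    rw [abs_mul, abs_of_nonneg (hτ0 b)]
    calc τ b * |c b h l| ≤ τ b * (C * Θ b * κ₁ ^ ((Jset b l).filter fun j => h ∈ A b l j).card) :=
          mul_le_mul_of_nonneg_left (hcg b hb h l hl) (hτ0 b)
      _ = C * (Θ b * τ b) * κ₁ ^ ((Jset b l).filter fun j => h ∈ A b l j).card := by ring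
  exact integral_sq_sub_towerMean_le_of_stepBudget_graded_geometric (κ := κ) ν n hφn hφR hCT
    (S := fun _ _ => sr * sc) hstep hWm' hWb' Mf hκ₁ (Θ := fun b => Θ b * τ b)
    (fun _ _ => mul_nonneg hsr hsc) (fun _ _ => le_rfl) Jset hA hc0' hcg' hε hE hdomA
    (mul_nonneg hsr hsc) hP hr0 hr1 hgeo

open scoped Classical in
/-- `[folklore]` **MI-ES END-TO-END, WHITENED FORM — arbitrary path law, any kernel version.** -/
theorem integral_sq_sub_towerMean_le_of_graded_geometric_whitened_pathLaw
    (μ : Measure (Π n, X n)) [IsFiniteMeasure μ]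
    (κ' : (b : ℕ) → Kernel (Π i : Iic b, X i) (X (b + 1))) [∀ b, IsMarkovKernel (κ' b)]
    (hκ' : ∀ b, μ.map (frestrictLe b) ⊗ₘ κ' b = μ.map (fun x => (frestrictLe b x, x (b + 1))))
    (n : ℕ) {φ : (Π k, X k) → ℝ} (hφn : StronglyMeasurable[piLE (X := X) n] φ) {R : ℝ}
    (hφR : ∀ x, |φ x| ≤ R)
    {Λ : ℕ → Type w} [∀ b, Fintype (Λ b)] [∀ b, DecidableEq (Λ b)]
    {ι : ℕ → Type u} [∀ b, Fintype (ι b)] [∀ b, DecidableEq (ι b)] {E : (b : ℕ) → ι b → Type v}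
    [∀ b i, MeasurableSpace (E b i)]
    {T : (b : ℕ) → (Π i : Iic b, X i) → (Λ b → ℝ) → X (b + 1)} (hT : ∀ b h, Measurable (T b h))
    (m : (b : ℕ) → (Π i : Iic b, X i) → Λ b → ℝ)
    (S : (b : ℕ) → (Π i : Iic b, X i) → Λ b → ι b → ℝ)
    {e : (b : ℕ) → (i : ι b) → E b i → ℝ} (he : ∀ b i, Measurable (e b i))
    (Q : (b : ℕ) → (Π i : Iic b, X i) → Measure ((i : ι b) → E b i))
    [∀ b h, IsProbabilityMeasure (Q b h)]
    (hrep : ∀ b < n, ∀ h, κ' b h = (Q b h).map (fun η => T b h (affine (m b h) (S b h) (e b) η)))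
    (q : (b : ℕ) → (Π i : Iic b, X i) → (i : ι b) → Kernel ((j : ι b) → E b j) (E b i))
    {CT : ℝ} (hCT : 0 ≤ CT)
    (hES : ∀ b < n, ∀ h, ∀ (G : ((i : ι b) → E b i) → ℝ) (B : ℝ), Measurable G →
      (∀ ξ, |G ξ| ≤ B) → ∫ ξ, (G ξ - ∫ ζ, G ζ ∂Q b h) ^ 2 ∂Q b h ≤
        CT * ((1 / 2 : ℝ) * ∑ i, ∫ ξ, (∫ y, (G ξ - G (Function.update ξ i y)) ^ 2
          ∂(q b h i ξ)) ∂Q b h))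
    {D : (b : ℕ) → (Π i : Iic b, X i) → Λ b → Set ℝ}
    (hD : ∀ b < n, ∀ h η l, affine (m b h) (S b h) (e b) η l ∈ D b h l)
    {c : (b : ℕ) → (Π i : Iic b, X i) → Λ b → ℝ}
    (hc : ∀ b < n, ∀ h, LipOn (D b h) (fun ξ => fiberMean κ' (b + 1) φ (succGlue b (h, T b h ξ)))
      (c b h))
    {τ : ℕ → ℝ} (hτ0 : ∀ b, 0 ≤ τ b)
    (hdi : ∀ b < n, ∀ h i η, Integrable (fun y => (e b i y - e b i (η i)) ^ 2) (q b h i η))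
    (hmom : ∀ b < n, ∀ h i η, ∫ y, (e b i y - e b i (η i)) ^ 2 ∂(q b h i η) ≤ τ b ^ 2)
    {sr sc : ℝ} (hsr : 0 ≤ sr) (hsc : 0 ≤ sc) (hcol : ∀ b < n, ∀ h i, ∑ l, |S b h l i| ≤ sc)
    (hrow : ∀ b < n, ∀ h l, ∑ i, |S b h l i| ≤ sr)
    (hWm : ∀ b, StronglyMeasurable (fun h => ∑ l, c b h l ^ 2)) {CW : ℝ}
    (hWb : ∀ b h, |∑ l, c b h l ^ 2| ≤ CW)
    (Mf : (b : ℕ) → Finset (Λ b)) {C κ₁ Etot : ℝ} (hκ₁ : 1 ≤ κ₁) {Θ : ℕ → ℝ}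
    {J : ℕ → Type*} (Jset : (b : ℕ) → Λ b → Finset (J b))
    {A : (b : ℕ) → Λ b → J b → Set (Π i : Iic b, X i)}
    (hA : ∀ b < n, ∀ l ∈ Mf b, ∀ j ∈ Jset b l, MeasurableSet (A b l j))
    (hc0 : ∀ b < n, ∀ h, ∀ l ∉ Mf b, c b h l = 0)
    (hcg : ∀ b < n, ∀ h, ∀ l ∈ Mf b,
      |c b h l| ≤ C * Θ b * κ₁ ^ ((Jset b l).filter fun j => h ∈ A b l j).card)
    {ε : (b : ℕ) → Λ b → J b → ℝ} (hε : ∀ b < n, ∀ l ∈ Mf b, ∀ j ∈ Jset b l, 0 ≤ ε b l j)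
    (hE : ∀ b < n, ∀ l ∈ Mf b, ∑ j ∈ Jset b l, ε b l j ≤ Etot)
    (hdomA : ∀ b < n, ∀ l ∈ Mf b, ∀ S' ⊆ Jset b l,
      μ.real (⋂ j ∈ S', {x | frestrictLe b x ∈ A b l j}) ≤ μ.real Set.univ * ∏ j ∈ S', ε b l j)
    {P r : ℝ} (hP : 0 ≤ P) (hr0 : 0 ≤ r) (hr1 : r < 1)
    (hgeo : ∀ b, ((Mf b).card : ℝ) * (Θ b * τ b) ^ 2 ≤ P * r ^ b) :
    ∫ x, (φ x - towerMean κ' φ (x 0)) ^ 2 ∂μ ≤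
      CT * ((1 / 2 : ℝ) * (C ^ 2 * (sr * sc)) *
        (μ.real Set.univ * Real.exp ((κ₁ ^ 2 - 1) * Etot)) * (P / (1 - r))) := by
  have hμ := trajMeasure_eq_of_compProd μ κ' hκ'
  have h := integral_sq_sub_towerMean_le_of_graded_geometric_whitened (κ := κ') (μ.map (fun x => x 0))
    n hφn hφR hT m S he Q hrep q hCT hES hD hc hτ0 hdi hmom hsr hsc hcol hrow hWm hWb Mf hκ₁ Jset hA
    hc0 hcg hε hE (by rw [hμ]; exact hdomA) hP hr0 hr1 hgeo
  rw [hμ, map_measureReal_apply (measurable_pi_apply 0) MeasurableSet.univ, Set.preimage_univ] at h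
  exact h

end EndToEnd

/-! ## §6 Resampling second moments of one-site Gibbs kernels from the one-site oscillation

In whitened coordinates the resampling kernels are the one-site Gibbs kernels
`qᵢ(η)(dy) ∝ exp (−A (update η i y)) πᵢ(dy)` of `T4DobrushinTensorisation` §7.  If the ONE-SITE
OSCILLATION of the energy is bounded, `A (update η i z) − A (update η i y) ≤ ω`, then the one-site
Gibbs density is `≤ exp ω` (`gibbsDensity_le_exp_of_osc`), so `∫ F dqᵢ(η) ≤ e^ω ∫ F dπᵢ` for
`F ≥ 0` and the resampling second moment of a reading `e` with `|e| ≤ p`, `∫ e² dπᵢ ≤ v` is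
`≤ e^ω (2v + 2p²)` uniformly in `η` (`integral_sq_sub_gibbsKernel_le`) — the binder `hmom` of §5
with `τ² = e^ω (2v + 2p²)`.  (Dictionary, not input: `πᵢ` = a unit Gaussian conditioned on the
small-field interval `[−p, p]`, `v ≤ 1`; `ω` = the one-site oscillation of the whitened
interaction on the small-field box, small with the coupling.) -/

section Moments

variable {ι : Type u} [Fintype ι] [DecidableEq ι] {E : ι → Type v} [∀ i, MeasurableSpace (E i)]
variable {π : (i : ι) → Measure (E i)} [∀ i, IsProbabilityMeasure (π i)]
  {A : ((j : ι) → E j) → ℝ}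

omit [Fintype ι] in
/-- `[folklore]` ONE-SITE OSCILLATION `≤ ω` ⇒ the one-site Gibbs density is `≤ exp ω`. -/
theorem gibbsDensity_le_exp_of_osc (hAm : Measurable A) {a : ℝ} (hAb : ∀ ξ, |A ξ| ≤ a) (i : ι)
    {ω : ℝ} (hω : ∀ (ξ : (j : ι) → E j) (y z : E i), A (update ξ i z) - A (update ξ i y) ≤ ω)
    (ξ : (j : ι) → E j) (y : E i) : gibbsDensity π A i ξ y ≤ Real.exp ω := by
  have hZ0 := siteZ_pos (π := π) hAm hAb i ξ
  have hint : Integrable (fun z => Real.exp (-A (update ξ i z))) (π i) :=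
    integrable_of_abs_le_const (μ := π i)
      (Real.measurable_exp.comp (hAm.comp (measurable_update ξ)).neg).stronglyMeasurable
      (R := Real.exp a) fun z => by
        rw [abs_of_pos (Real.exp_pos _)]; exact (exp_neg_energy_bounds hAb _).2
  have hZ : Real.exp (-A (update ξ i y) - ω) ≤ siteZ π A i ξ := by
    have h := integral_mono (integrable_const (Real.exp (-A (update ξ i y) - ω))) hint
      fun z => (Real.exp_le_exp.2 (by linarith [hω ξ y z]) :
        Real.exp (-A (update ξ i y) - ω) ≤ Real.exp (-A (update ξ i z)))
    simpa [siteZ, probReal_univ] using h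
  rw [gibbsDensity, div_le_iff₀ hZ0]
  calc Real.exp (-A (update ξ i y)) = Real.exp ω * Real.exp (-A (update ξ i y) - ω) := by
        rw [← Real.exp_add]; ring_nf
    _ ≤ Real.exp ω * siteZ π A i ξ := mul_le_mul_of_nonneg_left hZ (Real.exp_pos _).le

omit [Fintype ι] in
/-- `[folklore]` Under a one-site oscillation bound, `∫ F dqᵢ(ξ) ≤ e^ω ∫ F dπᵢ` for `F ≥ 0`. -/
theorem integral_gibbsKernel_le_exp_mul (hAm : Measurable A) {a : ℝ} (hAb : ∀ ξ, |A ξ| ≤ a)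
    (i : ι) {ω : ℝ}
    (hω : ∀ (ξ : (j : ι) → E j) (y z : E i), A (update ξ i z) - A (update ξ i y) ≤ ω)
    (ξ : (j : ι) → E j) {F : E i → ℝ} (hF0 : ∀ y, 0 ≤ F y) (hFi : Integrable F (π i)) :
    ∫ y, F y ∂(gibbsKernel π A i ξ) ≤ Real.exp ω * ∫ y, F y ∂(π i) := by
  rw [integral_gibbsKernel hAm hAb, ← integral_const_mul]
  exact integral_mono_of_nonneg
    (Filter.Eventually.of_forall fun y => mul_nonneg (gibbsDensity_bounds hAm hAb i ξ y).1 (hF0 y))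
    (hFi.const_mul _)
    (Filter.Eventually.of_forall fun y =>
      mul_le_mul_of_nonneg_right (gibbsDensity_le_exp_of_osc hAm hAb i hω ξ y) (hF0 y))

omit [Fintype ι] in
/-- `[folklore]` The squared increment of a bounded reading is integrable under the one-site
Gibbs kernel (the binder `hdi` of §5 in whitened coordinates). -/
theorem integrable_sq_sub_gibbsKernel (hAm : Measurable A) {a : ℝ} (hAb : ∀ ξ, |A ξ| ≤ a)
    (i : ι) {e : E i → ℝ} (he : Measurable e) {p : ℝ} (hep : ∀ x, |e x| ≤ p)
    (η : (j : ι) → E j) : Integrable (fun y => (e y - e (η i)) ^ 2) (gibbsKernel π A i η) := by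
  haveI := isMarkovKernel_gibbsKernel (π := π) hAm hAb i
  exact integrable_of_abs_le_const (μ := gibbsKernel π A i η)
    ((he.sub_const _).pow_const 2).stronglyMeasurable (R := (2 * p) ^ 2) fun y => by
      rw [abs_pow]
      refine pow_le_pow_left₀ (abs_nonneg _) ?_ 2
      calc |e y - e (η i)| ≤ |e y| + |e (η i)| := abs_sub _ _
        _ ≤ 2 * p := by linarith [hep y, hep (η i)]

omit [Fintype ι] in
/-- `[folklore]` **(ES-mom) IN WHITENED COORDINATES.**  One-site oscillation `≤ ω`, reading `e`
with `|e| ≤ p` and `∫ e² dπᵢ ≤ v` ⇒ `∫ (e y − e ηᵢ)² dqᵢ(η)(y) ≤ e^ω (2v + 2p²)` for every `η`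
(the binder `hmom` of §5 with `τ² = e^ω (2v + 2p²)`). -/
theorem integral_sq_sub_gibbsKernel_le (hAm : Measurable A) {a : ℝ} (hAb : ∀ ξ, |A ξ| ≤ a)
    (i : ι) {ω : ℝ}
    (hω : ∀ (ξ : (j : ι) → E j) (y z : E i), A (update ξ i z) - A (update ξ i y) ≤ ω)
    {e : E i → ℝ} (he : Measurable e) {p v : ℝ} (hep : ∀ x, |e x| ≤ p)
    (hv : ∫ y, e y ^ 2 ∂(π i) ≤ v) (η : (j : ι) → E j) :
    ∫ y, (e y - e (η i)) ^ 2 ∂(gibbsKernel π A i η) ≤ Real.exp ω * (2 * v + 2 * p ^ 2) := by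
  have hFi : Integrable (fun y => (e y - e (η i)) ^ 2) (π i) :=
    integrable_of_abs_le_const (μ := π i) ((he.sub_const _).pow_const 2).stronglyMeasurable
      (R := (2 * p) ^ 2) fun y => by
        rw [abs_pow]
        refine pow_le_pow_left₀ (abs_nonneg _) ?_ 2
        calc |e y - e (η i)| ≤ |e y| + |e (η i)| := abs_sub _ _
          _ ≤ 2 * p := by linarith [hep y, hep (η i)]
  have he2 : Integrable (fun y => e y ^ 2) (π i) :=
    integrable_of_abs_le_const (μ := π i) (he.pow_const 2).stronglyMeasurable (R := p ^ 2)
      fun y => by rw [abs_pow]; exact pow_le_pow_left₀ (abs_nonneg _) (hep y) 2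
  refine (integral_gibbsKernel_le_exp_mul hAm hAb i hω η (fun y => sq_nonneg _) hFi).trans
    (mul_le_mul_of_nonneg_left ?_ (Real.exp_pos _).le)
  have hx : e (η i) ^ 2 ≤ p ^ 2 := by
    rw [← sq_abs]; exact pow_le_pow_left₀ (abs_nonneg _) (hep _) 2
  calc ∫ y, (e y - e (η i)) ^ 2 ∂(π i)
      ≤ ∫ y, (2 * e y ^ 2 + 2 * e (η i) ^ 2) ∂(π i) :=
        integral_mono hFi ((he2.const_mul 2).add (integrable_const _)) fun y => by
          have := sq_nonneg (e y + e (η i))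
          nlinarith
    _ = 2 * ∫ y, e y ^ 2 ∂(π i) + 2 * e (η i) ^ 2 := by
        rw [integral_add (he2.const_mul 2) (integrable_const _), integral_const_mul, integral_const,
          smul_eq_mul, probReal_univ, one_mul]
    _ ≤ 2 * v + 2 * p ^ 2 := by linarith

end Moments

/-! ## §7 THE GIBBS FORM: whitened Gibbs innovation laws with small mixed second differences

§5 with `Q b h = gibbsMeasure (π b h) (A b h)`, `q b h i = gibbsKernel (π b h) (A b h) i` and the
Efron–Stein hypothesis DISCHARGED by `T4DobrushinTensorisation.efronSteinWith_of_gibbs_linear`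
(`C_T = 1/(1−α₀)` from mixed-second-difference row sums `≤ α₀ < 1`), and — in the `_boxed`
corollary — the moment binders discharged by §6.  After this section the tensorisation-side
analysis input of the NE1′ line is, per step and history: (W0) the whitened Gibbs representation
of the small-field innovation law; (W1) summable rows / columns of `|S b h|`; (W2) mixed second
differences of `A b h` with row sums `≤ α₀ < 1`; (W3) one-site oscillation `≤ ω`; plus the RAW
Lipschitz vectors on the raw small-field box and the graded-geometric profile — record v1.21,
MI-ES-W.  LOCATED in the record for the printed actions, not proved, not cited. -/

section Gibbs

open Preorder MeasureTheory.Filtration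

variable {X : ℕ → Type*} [∀ n, MeasurableSpace (X n)]

open scoped Classical in
/-- `[folklore]` **MI-ES END-TO-END, WHITENED GIBBS FORM — arbitrary path law, any kernel
version.** -/
theorem integral_sq_sub_towerMean_le_of_graded_geometric_whitenedGibbs_pathLaw
    (μ : Measure (Π n, X n)) [IsFiniteMeasure μ]
    (κ' : (b : ℕ) → Kernel (Π i : Iic b, X i) (X (b + 1))) [∀ b, IsMarkovKernel (κ' b)]
    (hκ' : ∀ b, μ.map (frestrictLe b) ⊗ₘ κ' b = μ.map (fun x => (frestrictLe b x, x (b + 1))))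
    (n : ℕ) {φ : (Π k, X k) → ℝ} (hφn : StronglyMeasurable[piLE (X := X) n] φ) {R : ℝ}
    (hφR : ∀ x, |φ x| ≤ R)
    {Λ : ℕ → Type w} [∀ b, Fintype (Λ b)] [∀ b, DecidableEq (Λ b)]
    {ι : ℕ → Type u} [∀ b, Fintype (ι b)] [∀ b, DecidableEq (ι b)] {E : (b : ℕ) → ι b → Type v}
    [∀ b i, MeasurableSpace (E b i)]
    {T : (b : ℕ) → (Π i : Iic b, X i) → (Λ b → ℝ) → X (b + 1)} (hT : ∀ b h, Measurable (T b h))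
    (m : (b : ℕ) → (Π i : Iic b, X i) → Λ b → ℝ)
    (S : (b : ℕ) → (Π i : Iic b, X i) → Λ b → ι b → ℝ)
    {e : (b : ℕ) → (i : ι b) → E b i → ℝ} (he : ∀ b i, Measurable (e b i))
    (π : (b : ℕ) → (Π i : Iic b, X i) → (i : ι b) → Measure (E b i))
    [∀ b h i, IsProbabilityMeasure (π b h i)]
    (A : (b : ℕ) → (Π i : Iic b, X i) → ((i : ι b) → E b i) → ℝ)
    (hAm : ∀ b h, Measurable (A b h)) {a : (b : ℕ) → (Π i : Iic b, X i) → ℝ}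
    (hAb : ∀ b h η, |A b h η| ≤ a b h)
    (hrep : ∀ b < n, ∀ h, κ' b h =
      (gibbsMeasure (π b h) (A b h)).map (fun η => T b h (affine (m b h) (S b h) (e b) η)))
    {δ : (b : ℕ) → (Π i : Iic b, X i) → ι b → ι b → ℝ} (hδ0 : ∀ b h i j, 0 ≤ δ b h i j)
    (hδ : ∀ b h (i j : ι b), j ≠ i → ∀ (ξ : (k : ι b) → E b k) (y y' : E b j) (z z' : E b i),
      (A b h (update (update ξ j y') i z) - A b h (update (update ξ j y) i z)) -
        (A b h (update (update ξ j y') i z') - A b h (update (update ξ j y) i z')) ≤ δ b h i j)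
    {α₀ : ℝ} (hα₀ : α₀ < 1) (hrowδ : ∀ b h (i : ι b), ∑ j ∈ univ.erase i, δ b h i j ≤ α₀)
    {D : (b : ℕ) → (Π i : Iic b, X i) → Λ b → Set ℝ}
    (hD : ∀ b < n, ∀ h η l, affine (m b h) (S b h) (e b) η l ∈ D b h l)
    {c : (b : ℕ) → (Π i : Iic b, X i) → Λ b → ℝ}
    (hc : ∀ b < n, ∀ h, LipOn (D b h) (fun ξ => fiberMean κ' (b + 1) φ (succGlue b (h, T b h ξ)))
      (c b h))
    {τ : ℕ → ℝ} (hτ0 : ∀ b, 0 ≤ τ b)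
    (hdi : ∀ b < n, ∀ h i η,
      Integrable (fun y => (e b i y - e b i (η i)) ^ 2) (gibbsKernel (π b h) (A b h) i η))
    (hmom : ∀ b < n, ∀ h i η,
      ∫ y, (e b i y - e b i (η i)) ^ 2 ∂(gibbsKernel (π b h) (A b h) i η) ≤ τ b ^ 2)
    {sr sc : ℝ} (hsr : 0 ≤ sr) (hsc : 0 ≤ sc) (hcol : ∀ b < n, ∀ h i, ∑ l, |S b h l i| ≤ sc)
    (hrow : ∀ b < n, ∀ h l, ∑ i, |S b h l i| ≤ sr)
    (hWm : ∀ b, StronglyMeasurable (fun h => ∑ l, c b h l ^ 2)) {CW : ℝ}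
    (hWb : ∀ b h, |∑ l, c b h l ^ 2| ≤ CW)
    (Mf : (b : ℕ) → Finset (Λ b)) {C κ₁ Etot : ℝ} (hκ₁ : 1 ≤ κ₁) {Θ : ℕ → ℝ}
    {J : ℕ → Type*} (Jset : (b : ℕ) → Λ b → Finset (J b))
    {Aev : (b : ℕ) → Λ b → J b → Set (Π i : Iic b, X i)}
    (hA : ∀ b < n, ∀ l ∈ Mf b, ∀ j ∈ Jset b l, MeasurableSet (Aev b l j))
    (hc0 : ∀ b < n, ∀ h, ∀ l ∉ Mf b, c b h l = 0)
    (hcg : ∀ b < n, ∀ h, ∀ l ∈ Mf b,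
      |c b h l| ≤ C * Θ b * κ₁ ^ ((Jset b l).filter fun j => h ∈ Aev b l j).card)
    {ε : (b : ℕ) → Λ b → J b → ℝ} (hε : ∀ b < n, ∀ l ∈ Mf b, ∀ j ∈ Jset b l, 0 ≤ ε b l j)
    (hE : ∀ b < n, ∀ l ∈ Mf b, ∑ j ∈ Jset b l, ε b l j ≤ Etot)
    (hdomA : ∀ b < n, ∀ l ∈ Mf b, ∀ S' ⊆ Jset b l,
      μ.real (⋂ j ∈ S', {x | frestrictLe b x ∈ Aev b l j}) ≤ μ.real Set.univ * ∏ j ∈ S', ε b l j)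
    {P r : ℝ} (hP : 0 ≤ P) (hr0 : 0 ≤ r) (hr1 : r < 1)
    (hgeo : ∀ b, ((Mf b).card : ℝ) * (Θ b * τ b) ^ 2 ≤ P * r ^ b) :
    ∫ x, (φ x - towerMean κ' φ (x 0)) ^ 2 ∂μ ≤
      (1 / (1 - α₀)) * ((1 / 2 : ℝ) * (C ^ 2 * (sr * sc)) *
        (μ.real Set.univ * Real.exp ((κ₁ ^ 2 - 1) * Etot)) * (P / (1 - r))) := by
  haveI : ∀ b h, IsProbabilityMeasure (gibbsMeasure (π b h) (A b h)) :=
    fun b h => isProbabilityMeasure_gibbsMeasure (hAm b h) (hAb b h)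
  have hCT : (0 : ℝ) ≤ 1 / (1 - α₀) := div_nonneg zero_le_one (by linarith)
  exact integral_sq_sub_towerMean_le_of_graded_geometric_whitened_pathLaw μ κ' hκ' n hφn hφR hT m S
    he (fun b h => gibbsMeasure (π b h) (A b h)) hrep (fun b h i => gibbsKernel (π b h) (A b h) i)
    hCT
    (fun b _ h => efronSteinWith_of_gibbs_linear (hAm b h) (hAb b h) (hδ0 b h) (hδ b h) hα₀
      (hrowδ b h))
    hD hc hτ0 hdi hmom hsr hsc hcol hrow hWm hWb Mf hκ₁ Jset hA hc0 hcg hε hE hdomA hP hr0 hr1 hgeo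

open scoped Classical in
/-- `[folklore]` **MI-ES END-TO-END, WHITENED GIBBS FORM ON A SMALL-FIELD BOX — every binder of
the tensorisation side explicit.**  As above, with the moment binders DISCHARGED by §6: readings
bounded by the box radius `p b` (level dependence allowed), reference second moments `≤ v`,
one-site oscillation of the energies `≤ ω`; the level moment is `τ b ² = e^ω (2v + 2 (p b)²)` and
the profile is asked in the form `#Mf b · Θ b² · e^ω (2v + 2 (p b)²) ≤ P r^b`. -/
theorem integral_sq_sub_towerMean_le_of_graded_geometric_whitenedGibbs_boxed_pathLaw
    (μ : Measure (Π n, X n)) [IsFiniteMeasure μ]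
    (κ' : (b : ℕ) → Kernel (Π i : Iic b, X i) (X (b + 1))) [∀ b, IsMarkovKernel (κ' b)]
    (hκ' : ∀ b, μ.map (frestrictLe b) ⊗ₘ κ' b = μ.map (fun x => (frestrictLe b x, x (b + 1))))
    (n : ℕ) {φ : (Π k, X k) → ℝ} (hφn : StronglyMeasurable[piLE (X := X) n] φ) {R : ℝ}
    (hφR : ∀ x, |φ x| ≤ R)
    {Λ : ℕ → Type w} [∀ b, Fintype (Λ b)] [∀ b, DecidableEq (Λ b)]
    {ι : ℕ → Type u} [∀ b, Fintype (ι b)] [∀ b, DecidableEq (ι b)] {E : (b : ℕ) → ι b → Type v}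
    [∀ b i, MeasurableSpace (E b i)]
    {T : (b : ℕ) → (Π i : Iic b, X i) → (Λ b → ℝ) → X (b + 1)} (hT : ∀ b h, Measurable (T b h))
    (m : (b : ℕ) → (Π i : Iic b, X i) → Λ b → ℝ)
    (S : (b : ℕ) → (Π i : Iic b, X i) → Λ b → ι b → ℝ)
    {e : (b : ℕ) → (i : ι b) → E b i → ℝ} (he : ∀ b i, Measurable (e b i))
    {p : ℕ → ℝ} (hep : ∀ b i x, |e b i x| ≤ p b)
    (π : (b : ℕ) → (Π i : Iic b, X i) → (i : ι b) → Measure (E b i))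
    [∀ b h i, IsProbabilityMeasure (π b h i)] {v : ℝ} (hv0 : 0 ≤ v)
    (hv : ∀ b h i, ∫ y, e b i y ^ 2 ∂(π b h i) ≤ v)
    (A : (b : ℕ) → (Π i : Iic b, X i) → ((i : ι b) → E b i) → ℝ)
    (hAm : ∀ b h, Measurable (A b h)) {a : (b : ℕ) → (Π i : Iic b, X i) → ℝ}
    (hAb : ∀ b h η, |A b h η| ≤ a b h)
    (hrep : ∀ b < n, ∀ h, κ' b h =
      (gibbsMeasure (π b h) (A b h)).map (fun η => T b h (affine (m b h) (S b h) (e b) η)))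
    {δ : (b : ℕ) → (Π i : Iic b, X i) → ι b → ι b → ℝ} (hδ0 : ∀ b h i j, 0 ≤ δ b h i j)
    (hδ : ∀ b h (i j : ι b), j ≠ i → ∀ (ξ : (k : ι b) → E b k) (y y' : E b j) (z z' : E b i),
      (A b h (update (update ξ j y') i z) - A b h (update (update ξ j y) i z)) -
        (A b h (update (update ξ j y') i z') - A b h (update (update ξ j y) i z')) ≤ δ b h i j)
    {α₀ : ℝ} (hα₀ : α₀ < 1) (hrowδ : ∀ b h (i : ι b), ∑ j ∈ univ.erase i, δ b h i j ≤ α₀)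
    {ω : ℝ} (hω : ∀ b h (i : ι b) (ξ : (j : ι b) → E b j) (y z : E b i),
      A b h (update ξ i z) - A b h (update ξ i y) ≤ ω)
    {D : (b : ℕ) → (Π i : Iic b, X i) → Λ b → Set ℝ}
    (hD : ∀ b < n, ∀ h η l, affine (m b h) (S b h) (e b) η l ∈ D b h l)
    {c : (b : ℕ) → (Π i : Iic b, X i) → Λ b → ℝ}
    (hc : ∀ b < n, ∀ h, LipOn (D b h) (fun ξ => fiberMean κ' (b + 1) φ (succGlue b (h, T b h ξ)))
      (c b h))
    {sr sc : ℝ} (hsr : 0 ≤ sr) (hsc : 0 ≤ sc) (hcol : ∀ b < n, ∀ h i, ∑ l, |S b h l i| ≤ sc)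
    (hrow : ∀ b < n, ∀ h l, ∑ i, |S b h l i| ≤ sr)
    (hWm : ∀ b, StronglyMeasurable (fun h => ∑ l, c b h l ^ 2)) {CW : ℝ}
    (hWb : ∀ b h, |∑ l, c b h l ^ 2| ≤ CW)
    (Mf : (b : ℕ) → Finset (Λ b)) {C κ₁ Etot : ℝ} (hκ₁ : 1 ≤ κ₁) {Θ : ℕ → ℝ}
    {J : ℕ → Type*} (Jset : (b : ℕ) → Λ b → Finset (J b))
    {Aev : (b : ℕ) → Λ b → J b → Set (Π i : Iic b, X i)}
    (hA : ∀ b < n, ∀ l ∈ Mf b, ∀ j ∈ Jset b l, MeasurableSet (Aev b l j))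
    (hc0 : ∀ b < n, ∀ h, ∀ l ∉ Mf b, c b h l = 0)
    (hcg : ∀ b < n, ∀ h, ∀ l ∈ Mf b,
      |c b h l| ≤ C * Θ b * κ₁ ^ ((Jset b l).filter fun j => h ∈ Aev b l j).card)
    {ε : (b : ℕ) → Λ b → J b → ℝ} (hε : ∀ b < n, ∀ l ∈ Mf b, ∀ j ∈ Jset b l, 0 ≤ ε b l j)
    (hE : ∀ b < n, ∀ l ∈ Mf b, ∑ j ∈ Jset b l, ε b l j ≤ Etot)
    (hdomA : ∀ b < n, ∀ l ∈ Mf b, ∀ S' ⊆ Jset b l,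
      μ.real (⋂ j ∈ S', {x | frestrictLe b x ∈ Aev b l j}) ≤ μ.real Set.univ * ∏ j ∈ S', ε b l j)
    {P r : ℝ} (hP : 0 ≤ P) (hr0 : 0 ≤ r) (hr1 : r < 1)
    (hgeo : ∀ b, ((Mf b).card : ℝ) * (Θ b ^ 2 * (Real.exp ω * (2 * v + 2 * p b ^ 2))) ≤ P * r ^ b) :
    ∫ x, (φ x - towerMean κ' φ (x 0)) ^ 2 ∂μ ≤
      (1 / (1 - α₀)) * ((1 / 2 : ℝ) * (C ^ 2 * (sr * sc)) *
        (μ.real Set.univ * Real.exp ((κ₁ ^ 2 - 1) * Etot)) * (P / (1 - r))) := by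
  -- the level moment `τ b = √(e^ω (2v + 2 p_b²))`
  have hm0 : ∀ b, 0 ≤ Real.exp ω * (2 * v + 2 * p b ^ 2) :=
    fun b => mul_nonneg (Real.exp_pos _).le (by positivity)
  set τ : ℕ → ℝ := fun b => Real.sqrt (Real.exp ω * (2 * v + 2 * p b ^ 2)) with hτ
  have hτsq : ∀ b, τ b ^ 2 = Real.exp ω * (2 * v + 2 * p b ^ 2) := fun b => Real.sq_sqrt (hm0 b)
  refine integral_sq_sub_towerMean_le_of_graded_geometric_whitenedGibbs_pathLaw μ κ' hκ' n hφn hφR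
    hT m S he π A hAm hAb hrep hδ0 hδ hα₀ hrowδ hD hc (τ := τ) (fun b => Real.sqrt_nonneg _)
    (fun b _ h i η => integrable_sq_sub_gibbsKernel (hAm b h) (hAb b h) i (he b i) (hep b i) η)
    (fun b _ h i η => (hτsq b).symm ▸
      integral_sq_sub_gibbsKernel_le (hAm b h) (hAb b h) i (hω b h i) (he b i) (hep b i)
        (hv b h i) η)
    hsr hsc hcol hrow hWm hWb Mf hκ₁ Jset hA hc0 hcg hε hE hdomA hP hr0 hr1 fun b => ?_
  rw [mul_pow, hτsq]
  exact hgeo b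

end Gibbs

end Literature.MathematicalPhysics.QuantumFieldTheory.Balaban1983to89.T4GaussianWhitening
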